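import Summits.QuantumFields.YangMills.Theses.CertificationLength

/-!
# Birth skeleton (BC3) for crux `CertifiedHypercubicLimit` (stmt-QuantumFields-16191) — `Lines/birth.lean`

Registrar: `planner-skel-stmt-QuantumFields-16191-0` (skeleton-register one-shot; route
`route-QuantumFields-CertificationLength`, re-audit bin REPAIRABLE), 2026-08-17. Line card: `Lines/birth.md`.

Crux (route file `Theses/CertificationLength.lean`, rev 6, decl
`Summit.QuantumFields.YangMills.Theses.CertificationLength.CertifiedHypercubicLimit`, rank 3 — the route's
EXISTENCE LEG AT THE CERTIFICATION SPACING): `(A) CompleteAnalyticityAtLargeScales →` for every compact simple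
`G` and faithful `r` there are admissible `(n, ε)` (`ε·M(n) < 1`), `ℓ₀ > 0`, certifying cell sizes `b_k ≥ 1`
(the Dobrushin–Shlosman TV finite-size condition holds at every `(β_k, b_k)`, `β_k ≥ 0`), a sequential Wilson
scheme `sch` with `a_k = ℓ₀/b_k`, tori `2L_k+1 ≥ (8n+7)b_k` and `log²(|c_k|+1) ≤ a_k L_k`, at WEAK COUPLING
(`sch.HasWeakCouplingLimit`), and a labelled Schwinger family `S` of ALL gauge-invariant lattice observables in
ONE-FIELD GAUGE (every string with a non-curvature label vanishes) carrying the HypercubicLimit package `W`: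
E0, E0′, E2, E3, E4, translation and proper-hypercubic invariance on `⁰𝒮`, `IsYangMillsFor`-convergence along
`sch`, non-trivial and non-Gaussian curvature field, and ONE rate `Δ > 0` with `S.HasMassGap Δ ∧
HasLatticeMassGap r sch Δ`.

## The cut = the route's own TWO-LAYER PLAN for this node (route header, "CertifiedHypercubicLimit ⇐
InfraredClausesAtCertificationScale → UltravioletTightnessBelowCertification")

Three named pieces — one ∃-leg (ultraviolet) and two ∀-legs (infrared), none of them the crux or the summit:

* `stub_ultravioletLeg` (∃, the OPEN CORE; XL / open-problem) — **the crux with its two infrared clauses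
  (E4 `HasClusterProperty` and the gap conjunct `∃ Δ > 0, S.HasMassGap Δ ∧ HasLatticeMassGap r sch Δ`)
  deleted**, every other clause VERBATIM: from (A), the certified weak-coupling Wilson scheme at spacing
  `a_k = ℓ₀/b_k` (scheme selection from (A) is elementary: `β_k := max(β₂(k+1), k)`, `b_k ≥ k+1` certified)
  AND a limit family `S` in one-field gauge with convergence of ALL renormalised species strings on
  off-diagonal real product tensors, E0 (`IsNormalized`, `IsHermitian`), E0′ (`HasLinearGrowth`), E2, E3,
  translation and proper-hypercubic invariance, `IsNontrivial`- and `IsNonGaussian`-witnesses of the curvature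
  field.  This is where tightness / E0′ / `κ₃ ≠ 0` of renormalised `tr F²` BELOW the certification length
  live (Bałaban-class UV stability with observables; barrier `UVStabilityNonUniqueness` not evaded) and where
  the ultralocality risk sits (`FixedCouplingUltralocality`: if every certifying scale is `≫ ξ(β)` the limit is
  ultralocal and the NT clause fails).  No clustering, no gap is claimed: alone it inhabits nothing gapped.
  The lattice-inherited symmetries (E2, E3, E0-hermiticity, translations, hypercubic frames) are kept INSIDE
  the ∃-leg on purpose: for the composite `tr F²` they hold on the lattice only up to `O(a_k)` shifts of
  plaquette COMPONENTS, whose control is UV information of the constructor, not a consequence of convergence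
  of the scheme's own species (a universally quantified "inheritance" stub would not be honest).
* `stub_latticeGap` (∀; M, PROVABLE NOW) — stated BY NAME as the route's support item
  `LatticeGapAtCertificationScale` (stmt-QuantumFields-16182): certificates at `(β_k, b_k)`, `a_k = ℓ₀/b_k`,
  `2L_k+1 ≥ (8n+7)b_k` ⇒ `∃ Δ > 0, HasLatticeMassGap r sch Δ` — the PROVED engine `FiniteSizeCriterion`
  (OneCertifiedCube, stmt-8895) gives `|⟨A;τ_tB⟩| ≤ C(A,B) e^{−κ t/b_k} = C e^{−(κ/ℓ₀)·a_k t}` with `C`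
  independent of `β, b, S`.  When 16182 lands, this stub closes by `exact`.
* `stub_infraredTransfer` (∀; L–XL, "provable-grade" per the route header) — the INFRARED HALF OF THE PACKAGE
  for the limit: along ANY certified scheme as above (certificates, `a_k = ℓ₀/b_k`, tori incl. the `log²`
  clause), every one-field-gauge family `S` to which all renormalised species strings converge and which
  carries the ultraviolet package of Stub 1 (E0, E0′, E2, E3, translations, hypercubic frames) satisfies E4
  AND `∃ Δ > 0, S.HasMassGap Δ` (continuum gap of ALL species strings; non-curvature strings vanish).  Intended
  proof (route header): DS certificate ⇒ unique infinite-volume state at every `β_k` (support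
  `UniqueStateFromCertificate`, stmt-16183, PROVED `uniqueStateFromCertificate_proof`) with torus-vs-`μ_k`
  error beaten by the `log²` clause ⇒ volume-uniform SPECTRAL gap `e^{−κ a_k/ℓ₀}` of the transfer matrices in
  all four axis directions (complete analyticity is hypercubic-symmetric; `latticeClustering_iff_gap`,
  Literature `LatticeMassGap`) ⇒ the NORM-UNIFORM Cauchy–Schwarz clustering
  `|⟨v,(Tⁿ−P_Ω)w⟩| ≤ e^{−Δ a_k n}‖v‖‖w‖` whose constants are reflection-positive norms = lattice Schwinger
  functions, hence CONVERGENT (the per-pair constants of `HasLatticeMassGap` do not transfer — this is why the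
  stub consumes the certificate, not Stub 2) ⇒ `S.HasMassGap Δ` on slab-ordered spans and then on all
  time-ordered tests (Literature `MassGapFromSpanClustering` / `MassGapFromDiagonalClustering` /
  `OSReconstructionNoE1`, `SchwartzOrderedWedgeDensity`); E4 along a spatial direction `a⃗` by the same bound
  for the transfer matrix of an axis `e_j` with `a_j ≠ 0` (RP across `x_j = 0` is E2 transported by a det-1
  signed permutation — the hypercubic hypothesis), plus `SchwartzTranslationCutoff` for the tails.
* `CertifiedHypercubicLimit_of` — the composition, a real proof (no `sorry` outside the stubs): Stub 1 gives the
  scheme, `S` and every UV clause; Stub 2 a lattice rate `Δ₁`; Stub 3 E4 and a continuum rate `Δ₂`; the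
  common rate is `min Δ₁ Δ₂` by the two antitonicity lemmas `hasMassGap_anti`, `hasLatticeMassGap_anti`
  (re-proved here, 8 lines each; the common rate is not load-bearing, cf. sibling Disproof §5c
  `gaps_iff_separate` of crux HypercubicLimit); concludes the route decl BY NAME.  The `example` after it is
  the same glue with the three stub STATEMENTS as explicit hypotheses (sorry-free by construction).

## Disproof used
No `Cruxes/CertifiedHypercubicLimit/Disproof.lean` exists (no workfiles before this one); `ledger negatives
--problem QuantumFields` (5 entries, 2026-08-17): none concerns these statements (the YangMills entry, item 9665
`DiagonalMirrorRP`, is route MirrorModularBoosts' free-`S₁ 0` diagonal-RP shape, not asked here).  Honoured from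
the sibling crux `HypercubicLimit` (stmt-8646; `Cruxes/HypercubicLimit/Disproof.lean` and the landed
`Theorems/HypercubicLimit/Negative/*`): non-abelianness is load-bearing (`hypercubicLimit_false_without_nonabelian`,
`weakCoupling_false_without_nonabelian`) — `stub_ultravioletLeg` carries `IsCompactSimpleLieGroup G` and the NT
witness; `β_k` must leave `0` (`BetaMustLeaveZero`) — the ∃-leg is at weak coupling `β_k → ∞`; the lattice gap is
asked only for `n ≤ S` (`not_hasLatticeMassGapAllTimes` kills the all-times strengthening) — Stub 2 is the
Literature `HasLatticeMassGap` verbatim; the one-field witness is legal (`hypercubicLimit_iff_oneField`,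
`OneFieldReduction`) — the crux is already in one-field gauge; the common rate is not load-bearing
(`gaps_iff_separate`) — the glue takes `min`.

## Audit (registrar folder `bc/`)
`lean check --json`: rc 0; sorries = 3 = stubs (`stub_ultravioletLeg`, `stub_latticeGap`,
`stub_infraredTransfer`), zero elsewhere (`hasMassGap_anti`, `hasLatticeMassGap_anti`,
`CertifiedHypercubicLimit_of` modulo the stubs, the hypotheses-form `example`); axioms of
`CertifiedHypercubicLimit_of` = {propext, Classical.choice, Quot.sound, sorryAx-via-stubs}.  BC3 probes (registrar
folder `bc/CertifiedHypercubicLimit_probe{1,2,3}.lean`, importing only the route file, each stub statement copied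
verbatim as a `def StubN`): `StubN → CertifiedHypercubicLimit` and `StubN → YangMills` by
`first | exact? | simpa | simpa [StubN] | (unfold StubN; simpa) | aesop` under `maxHeartbeats 400000`: FAIL 6/6
(Stub2: `aesop: failed to prove the goal after exhaustive search`, unsolved `⊢ CertifiedHypercubicLimit` /
`⊢ YangMills`; Stub1, Stub3: heartbeat cap reached inside the combinator).  Per-tactic split
(`…_probe{1,3}b.lean`, one `example` per alternative, own budget): FAIL 24/24 — `exact?` "could not close the
goal", `simpa` "assumption failed", `aesop` "failed after exhaustive search", and the three unfolded variants
reach the 400000-heartbeat cap at `whnf` (both targets, both stubs).  Namespace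
`Summit.QuantumFields.YangMills.Cruxes.CertifiedHypercubicLimit.Birth`.
-/

set_option autoImplicit false

namespace Summit.QuantumFields.YangMills.Cruxes.CertifiedHypercubicLimit.Birth

open scoped BigOperators Topology Manifold Classical MeasureTheory ProbabilityTheory Matrix InnerProductSpace
  ComplexConjugate ContinuousMap
open Filter Set Function TopologicalSpace MeasureTheory
open Literature.MathematicalPhysics.QuantumLattice Literature.MathematicalPhysics.AQFT
  Literature.MathematicalPhysics.QuantumFieldTheory

/-! ## § Stubs — the ONLY three `sorry`s of the file -/

/-- **Stub 1 `stub_ultravioletLeg` — the ∃-leg: the certified weak-coupling Wilson scheme at the certification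
spacing and its ULTRAVIOLET package (XL; open-problem).**  VERBATIM the crux with the two infrared clauses
(`S.HasClusterProperty` and `∃ Δ > 0, S.HasMassGap Δ ∧ HasLatticeMassGap r sch Δ`) deleted: given (A), for every
compact simple `G` (Borel σ-algebra) and faithful `r` there are admissible `(n, ε)`, `ℓ₀ > 0`, certifying sizes
`b_k` at couplings `β_k ≥ 0`, a scheme with `a_k = ℓ₀/b_k`, tori `2L_k+1 ≥ (8n+7)b_k`, `log²(|c_k|+1) ≤ a_k L_k`,
`β_k → ∞`, and a one-field-gauge labelled family `S` with: convergence of all renormalised species strings on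
off-diagonal real product tensors, E0 (`IsNormalized`, `IsHermitian`), E0′, E2, E3, translation and
proper-hypercubic invariance on `⁰𝒮`, and the `IsNontrivial` / `IsNonGaussian` witnesses of the curvature field.
No clustering, no gap. -/
theorem stub_ultravioletLeg :
    let E := EuclideanSpace ℝ (Fin 4)
    Summit.QuantumFields.YangMills.Theses.CertificationLength.CompleteAnalyticityAtLargeScales →
    ∀ (G : Type) [Group G] [TopologicalSpace G] [IsTopologicalGroup G] [CompactSpace G] [MeasurableSpace G]
      [BorelSpace G], IsCompactSimpleLieGroup G → ∀ r : LatticeRep G,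
      ∃ (n : ℕ) (ε ℓ₀ : ℝ) (bseq : ℕ → ℕ) (sch : SpeciesScheme (YMSpecies G)) (S : LabelledSchwingerFamily (YMSpecies G) E),
      1 ≤ n ∧ 0 ≤ ε ∧ ε * (((4 * n + 3) ^ 4 - (4 * n + 1) ^ 4 : ℕ) : ℝ) < 1 ∧ 0 < ℓ₀ ∧
      (∀ k, 0 ≤ sch.β k ∧ 1 ≤ bseq k ∧
        (∀ w : Fin 4 → ℤ → ℤ, (∀ i j, w i j + (bseq k : ℤ) ≤ w i (j + 1) ∧ w i (j + 1) ≤ w i j + 2 * (bseq k : ℤ)) →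
          ∀ Y : Finset (Fin 4 → ℤ), Y ⊆ (Fintype.piFinset fun _ : Fin 4 => Finset.Icc (-(2 * (n : ℤ))) (2 * (n : ℤ))) →
          (0 : Fin 4 → ℤ) ∈ Y → ∀ η η' : LGConfig 4 G,
          (∀ e ∈ (Fintype.piFinset fun _ : Fin 4 => Finset.Icc (-(2 * (n : ℤ))) (2 * (n : ℤ))).biUnion
            (fun y : Fin 4 → ℤ => (Fintype.piFinset fun i : Fin 4 => Finset.Ico (w i (y i)) (w i (y i + 1))) ×ˢ
              (Finset.univ : Finset (Fin 4))), η e = η' e) →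
          ∀ f : LGConfig 4 G → ℝ, IsCylinder f ((fun y : Fin 4 → ℤ => (Fintype.piFinset fun i : Fin 4 =>
            Finset.Ico (w i (y i)) (w i (y i + 1))) ×ˢ (Finset.univ : Finset (Fin 4))) 0) → Measurable f →
          (∀ U, 0 ≤ f U ∧ f U ≤ 1) →
          |(∫ U, f U ∂(ymSpecification r.ρ (sch.β k) (Y.biUnion (fun y : Fin 4 → ℤ => (Fintype.piFinset
              fun i : Fin 4 => Finset.Ico (w i (y i)) (w i (y i + 1))) ×ˢ (Finset.univ : Finset (Fin 4)))) η)) -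
            ∫ U, f U ∂(ymSpecification r.ρ (sch.β k) (Y.biUnion (fun y : Fin 4 → ℤ => (Fintype.piFinset
              fun i : Fin 4 => Finset.Ico (w i (y i)) (w i (y i + 1))) ×ˢ (Finset.univ : Finset (Fin 4)))) η')| ≤ ε)) ∧
      (∀ k, sch.a k = ℓ₀ / (bseq k : ℝ)) ∧
      (∀ k, (8 * n + 7) * bseq k ≤ 2 * sch.L k + 1 ∧ Real.log (|sch.c r.curvature k| + 1) ^ 2 ≤ sch.a k * sch.L k) ∧
      sch.HasWeakCouplingLimit ∧
      (∀ n k, (∃ i, k i ≠ r.curvature) → ∀ F, S n k F = 0) ∧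
      (∀ n, n ≠ 0 → ∀ (σ : Fin n → YMSpecies G) (f : Fin n → SchwartzMap E ℝ) (F : SchwartzMap (Fin n → E) ℂ),
        IsTensorOf F (fun i => ofRealTest (f i)) → IsOffDiagonal F →
        Filter.Tendsto (fun k => (latticeSchwinger r.ρ sch (fun s => s.F) k n σ f : ℂ)) Filter.atTop (nhds (S n σ F))) ∧
      S.IsNormalized ∧
      S.IsHermitian ∧
      S.HasLinearGrowth ∧
      S.IsReflectionPositive ∧
      S.IsSymmetric ∧
      (∀ (n : ℕ) (k : Fin n → YMSpecies G) (a : E) (F : SchwartzMap (Fin n → E) ℂ), IsOffDiagonal F →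
        S n k (translateMulti a F) = S n k F) ∧
      (∀ (n : ℕ) (k : Fin n → YMSpecies G) (R : E ≃ₗᵢ[ℝ] E), LinearMap.det (R.toLinearEquiv : E →ₗ[ℝ] E) = 1 →
        (∀ i : Fin 4, ∃ j : Fin 4, R (EuclideanSpace.single i 1) = EuclideanSpace.single j 1 ∨
          R (EuclideanSpace.single i 1) = -EuclideanSpace.single j 1) →
        ∀ F : SchwartzMap (Fin n → E) ℂ, IsOffDiagonal F → S n k (linActMulti R F) = S n k F) ∧
      (∃ (F₁ G₁ : SchwartzMap (Fin 1 → E) ℂ) (H₁ : SchwartzMap (Fin (1 + 1) → E) ℂ), IsTimeOrdered F₁ ∧ IsTimeOrdered G₁ ∧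
        IsAppendTensorOf H₁ (osAdjoint F₁) G₁ ∧
        S (1 + 1) (fun _ => r.curvature) H₁ ≠ S 1 (fun _ => r.curvature) (osAdjoint F₁) * S 1 (fun _ => r.curvature) G₁) ∧
      (∃ (f g h : SchwartzMap E ℂ) (Ffgh : SchwartzMap (Fin 3 → E) ℂ) (Fgh Ffh Ffg : SchwartzMap (Fin 2 → E) ℂ)
        (Ff Fg Fh : SchwartzMap (Fin 1 → E) ℂ), IsTensorOf Ffgh ![f, g, h] ∧ IsOffDiagonal Ffgh ∧ IsTensorOf Fgh ![g, h] ∧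
        IsTensorOf Ffh ![f, h] ∧ IsTensorOf Ffg ![f, g] ∧ IsTensorOf Ff ![f] ∧ IsTensorOf Fg ![g] ∧ IsTensorOf Fh ![h] ∧
        S 3 (fun _ => r.curvature) Ffgh - S 1 (fun _ => r.curvature) Ff * S 2 (fun _ => r.curvature) Fgh -
          S 1 (fun _ => r.curvature) Fg * S 2 (fun _ => r.curvature) Ffh -
          S 1 (fun _ => r.curvature) Fh * S 2 (fun _ => r.curvature) Ffg +
          2 * (S 1 (fun _ => r.curvature) Ff * S 1 (fun _ => r.curvature) Fg * S 1 (fun _ => r.curvature) Fh) ≠ 0) := by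
  sorry

/-- **Stub 2 `stub_latticeGap` — the uniform lattice gap at the certification spacing (M; provable now)**, BY
NAME the route's support item `LatticeGapAtCertificationScale` (stmt-QuantumFields-16182): for every compact `G`,
faithful `r`, admissible `(n, ε)`, `ℓ₀ > 0`, certifying sizes `b_k` at the scheme's couplings with
`a_k = ℓ₀/b_k` and `2L_k+1 ≥ (8n+7)b_k` there is `Δ > 0` (`= κ(n,ε)/ℓ₀`) with `HasLatticeMassGap r sch Δ` — from
the PROVED engine `FiniteSizeCriterion` (route OneCertifiedCube, stmt-QuantumFields-8895), whose constant `C(A,B)`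
is independent of `β, b, S`. -/
theorem stub_latticeGap :
    Summit.QuantumFields.YangMills.Theses.CertificationLength.LatticeGapAtCertificationScale := by
  sorry

/-- **Stub 3 `stub_infraredTransfer` — the infrared half of the package for the limit: E4 and the continuum gap
from the certificates (L–XL; the norm-uniform transfer-matrix upgrade).**  For every compact `G` (Borel
σ-algebra), faithful `r`, admissible `(n, ε)`, `ℓ₀ > 0`, sizes `bseq`, scheme `sch` and labelled family `S`: if
the TV finite-size condition holds at every `(β_k, b_k)` (`β_k ≥ 0`, `b_k ≥ 1`), `a_k = ℓ₀/b_k`,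
`2L_k+1 ≥ (8n+7)b_k` and `log²(|c_k|+1) ≤ a_k L_k`, `S` is in one-field gauge, all renormalised species strings
converge to `S` on off-diagonal real product tensors, and `S` has E0, E0′, E2, E3, translation and
proper-hypercubic invariance (exactly Stub 1's ultraviolet package), then `S` has the cluster property E4 and a
mass gap `∃ Δ > 0, S.HasMassGap Δ` of ALL species strings.  Mechanism: DS certificate ⇒ unique state
(`UniqueStateFromCertificate`, proved) ⇒ volume-uniform spectral gap of the axis transfer matrices at rate
`κ a_k/ℓ₀` ⇒ Cauchy–Schwarz clustering with reflection-positive norms (= convergent lattice Schwinger functions)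
⇒ `HasMassGap` / E4 of the limit on slab-ordered spans, then density (`MassGapFromSpanClustering`,
`OSReconstructionNoE1`, `SchwartzTranslationCutoff`). -/
theorem stub_infraredTransfer :
    let E := EuclideanSpace ℝ (Fin 4)
    ∀ (G : Type) [Group G] [TopologicalSpace G] [IsTopologicalGroup G] [CompactSpace G] [MeasurableSpace G]
      [BorelSpace G] (r : LatticeRep G) (n : ℕ) (ε ℓ₀ : ℝ) (bseq : ℕ → ℕ) (sch : SpeciesScheme (YMSpecies G))
      (S : LabelledSchwingerFamily (YMSpecies G) E),
      1 ≤ n → 0 ≤ ε → ε * (((4 * n + 3) ^ 4 - (4 * n + 1) ^ 4 : ℕ) : ℝ) < 1 → 0 < ℓ₀ →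
      (∀ k, 0 ≤ sch.β k ∧ 1 ≤ bseq k ∧
        (∀ w : Fin 4 → ℤ → ℤ, (∀ i j, w i j + (bseq k : ℤ) ≤ w i (j + 1) ∧ w i (j + 1) ≤ w i j + 2 * (bseq k : ℤ)) →
          ∀ Y : Finset (Fin 4 → ℤ), Y ⊆ (Fintype.piFinset fun _ : Fin 4 => Finset.Icc (-(2 * (n : ℤ))) (2 * (n : ℤ))) →
          (0 : Fin 4 → ℤ) ∈ Y → ∀ η η' : LGConfig 4 G,
          (∀ e ∈ (Fintype.piFinset fun _ : Fin 4 => Finset.Icc (-(2 * (n : ℤ))) (2 * (n : ℤ))).biUnion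
            (fun y : Fin 4 → ℤ => (Fintype.piFinset fun i : Fin 4 => Finset.Ico (w i (y i)) (w i (y i + 1))) ×ˢ
              (Finset.univ : Finset (Fin 4))), η e = η' e) →
          ∀ f : LGConfig 4 G → ℝ, IsCylinder f ((fun y : Fin 4 → ℤ => (Fintype.piFinset fun i : Fin 4 =>
            Finset.Ico (w i (y i)) (w i (y i + 1))) ×ˢ (Finset.univ : Finset (Fin 4))) 0) → Measurable f →
          (∀ U, 0 ≤ f U ∧ f U ≤ 1) →
          |(∫ U, f U ∂(ymSpecification r.ρ (sch.β k) (Y.biUnion (fun y : Fin 4 → ℤ => (Fintype.piFinset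
              fun i : Fin 4 => Finset.Ico (w i (y i)) (w i (y i + 1))) ×ˢ (Finset.univ : Finset (Fin 4)))) η)) -
            ∫ U, f U ∂(ymSpecification r.ρ (sch.β k) (Y.biUnion (fun y : Fin 4 → ℤ => (Fintype.piFinset
              fun i : Fin 4 => Finset.Ico (w i (y i)) (w i (y i + 1))) ×ˢ (Finset.univ : Finset (Fin 4)))) η')| ≤ ε)) →
      (∀ k, sch.a k = ℓ₀ / (bseq k : ℝ)) →
      (∀ k, (8 * n + 7) * bseq k ≤ 2 * sch.L k + 1 ∧ Real.log (|sch.c r.curvature k| + 1) ^ 2 ≤ sch.a k * sch.L k) →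
      (∀ n k, (∃ i, k i ≠ r.curvature) → ∀ F, S n k F = 0) →
      (∀ n, n ≠ 0 → ∀ (σ : Fin n → YMSpecies G) (f : Fin n → SchwartzMap E ℝ) (F : SchwartzMap (Fin n → E) ℂ),
        IsTensorOf F (fun i => ofRealTest (f i)) → IsOffDiagonal F →
        Filter.Tendsto (fun k => (latticeSchwinger r.ρ sch (fun s => s.F) k n σ f : ℂ)) Filter.atTop (nhds (S n σ F))) →
      S.IsNormalized →
      S.IsHermitian →
      S.HasLinearGrowth →
      S.IsReflectionPositive →
      S.IsSymmetric →
      (∀ (n : ℕ) (k : Fin n → YMSpecies G) (a : E) (F : SchwartzMap (Fin n → E) ℂ), IsOffDiagonal F →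
        S n k (translateMulti a F) = S n k F) →
      (∀ (n : ℕ) (k : Fin n → YMSpecies G) (R : E ≃ₗᵢ[ℝ] E), LinearMap.det (R.toLinearEquiv : E →ₗ[ℝ] E) = 1 →
        (∀ i : Fin 4, ∃ j : Fin 4, R (EuclideanSpace.single i 1) = EuclideanSpace.single j 1 ∨
          R (EuclideanSpace.single i 1) = -EuclideanSpace.single j 1) →
        ∀ F : SchwartzMap (Fin n → E) ℂ, IsOffDiagonal F → S n k (linActMulti R F) = S n k F) →
      S.HasClusterProperty ∧ ∃ Δ : ℝ, 0 < Δ ∧ S.HasMassGap Δ := by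
  sorry

/-! ## § Glue lemmas — sorry-free: the common rate is not load-bearing -/

/-- The continuum gap clause is antitone in the rate: a gap `Δ` is a gap `Δ' ≤ Δ`. [folklore] -/
theorem hasMassGap_anti {ι : Type} {d : ℕ} [NeZero d] {S : LabelledSchwingerFamily ι (EuclideanSpace ℝ (Fin d))}
    {Δ Δ' : ℝ} (h : S.HasMassGap Δ) (hle : Δ' ≤ Δ) : S.HasMassGap Δ' := by
  intro n m k k' F G hF hG
  obtain ⟨C, hC⟩ := h n m k k' F G hF hG
  refine ⟨max C 0, fun t ht H hH => (hC t ht H hH).trans ?_⟩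
  calc C * Real.exp (-Δ * t) ≤ max C 0 * Real.exp (-Δ * t) :=
        mul_le_mul_of_nonneg_right (le_max_left _ _) (Real.exp_nonneg _)
    _ ≤ max C 0 * Real.exp (-Δ' * t) := by
        refine mul_le_mul_of_nonneg_left (Real.exp_le_exp.2 ?_) (le_max_right _ _)
        nlinarith

/-- The lattice gap clause is antitone in the rate: a lattice gap `Δ` is a lattice gap `Δ' ≤ Δ` (spacings are
positive). [folklore] -/
theorem hasLatticeMassGap_anti {G : Type} [Group G] [TopologicalSpace G] [IsTopologicalGroup G] [CompactSpace G]
    [MeasurableSpace G] [BorelSpace G] {ι : Type} (r : LatticeRep G) (sch : SpeciesScheme ι) {Δ Δ' : ℝ}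
    (h : HasLatticeMassGap r sch Δ) (hle : Δ' ≤ Δ) : HasLatticeMassGap r sch Δ' := by
  intro A B
  obtain ⟨C, hC⟩ := h A B
  refine ⟨max C 0, hC.mono fun k hk S hS n hn => (hk S hS n hn).trans ?_⟩
  calc C * Real.exp (-(Δ * (sch.a k * n))) ≤ max C 0 * Real.exp (-(Δ * (sch.a k * n))) :=
        mul_le_mul_of_nonneg_right (le_max_left _ _) (Real.exp_nonneg _)
    _ ≤ max C 0 * Real.exp (-(Δ' * (sch.a k * n))) := by
        refine mul_le_mul_of_nonneg_left (Real.exp_le_exp.2 ?_) (le_max_right _ _)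
        have : 0 ≤ sch.a k * n := mul_nonneg (sch.a_pos k).le (Nat.cast_nonneg n)
        nlinarith

/-! ## § Assembly — sorry-free glue; concludes the route decl BY NAME -/

set_option maxHeartbeats 800000 in
/-- **Composition**: the three stubs BY NAME give the crux BY NAME.  Stub 1: the certified weak-coupling scheme
at spacing `ℓ₀/b_k`, the one-field-gauge limit `S` and every ultraviolet clause; Stub 2: a lattice rate `Δ₁`;
Stub 3: E4 and a continuum rate `Δ₂`; common rate `min Δ₁ Δ₂` by antitonicity. -/
theorem CertifiedHypercubicLimit_of :
    Summit.QuantumFields.YangMills.Theses.CertificationLength.CertifiedHypercubicLimit := by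
  intro hA G _ _ _ _ hG
  letI : MeasurableSpace G := borel G
  haveI : BorelSpace G := ⟨rfl⟩
  show ∀ r : LatticeRep G, _
  intro r
  -- Stub 1: scheme, limit family and the ultraviolet package
  obtain ⟨n, ε, ℓ₀, bseq, sch, S, hn, hε, hM, hℓ, hcert, ha, hL, hweak, hzero, hconv, hnorm, hherm, hgrowth,
    hrp, hsymm, htr, hhyp, hnt, hng⟩ := stub_ultravioletLeg hA G hG r
  -- Stub 2: the uniform lattice gap at the certification spacing (support item 16182, by name)
  obtain ⟨Δ₁, hΔ₁, hlat⟩ := stub_latticeGap G r n ε hn hε hM ℓ₀ hℓ bseq sch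
    (fun k => ⟨(hcert k).2.1, (hcert k).2.2⟩) ha (fun k => (hL k).1)
  -- Stub 3: E4 and the continuum gap of the limit from the certificates
  obtain ⟨hclus, Δ₂, hΔ₂, hgap⟩ := stub_infraredTransfer G r n ε ℓ₀ bseq sch S hn hε hM hℓ hcert ha hL hzero
    hconv hnorm hherm hgrowth hrp hsymm htr hhyp
  -- the package `W r sch S` with the common rate `min Δ₁ Δ₂`
  exact ⟨n, ε, ℓ₀, bseq, sch, S, hn, hε, hM, hℓ, hcert, ha, hL, hweak, hzero,
    ⟨hnorm, hherm, hgrowth, hrp, hsymm, hclus, htr, hhyp⟩, hconv, hnt, hng, min Δ₁ Δ₂, lt_min hΔ₁ hΔ₂,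
    hasMassGap_anti hgap (min_le_right _ _), hasLatticeMassGap_anti r sch hlat (min_le_left _ _)⟩

set_option maxHeartbeats 800000 in
/-- **The glue alone, `sorry`-free**: the three stub STATEMENTS (verbatim) imply the crux; this `example` does
not mention the stubs. -/
example
    (h₁ : let E := EuclideanSpace ℝ (Fin 4)
      Summit.QuantumFields.YangMills.Theses.CertificationLength.CompleteAnalyticityAtLargeScales →
      ∀ (G : Type) [Group G] [TopologicalSpace G] [IsTopologicalGroup G] [CompactSpace G] [MeasurableSpace G]
        [BorelSpace G], IsCompactSimpleLieGroup G → ∀ r : LatticeRep G,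
        ∃ (n : ℕ) (ε ℓ₀ : ℝ) (bseq : ℕ → ℕ) (sch : SpeciesScheme (YMSpecies G)) (S : LabelledSchwingerFamily (YMSpecies G) E),
        1 ≤ n ∧ 0 ≤ ε ∧ ε * (((4 * n + 3) ^ 4 - (4 * n + 1) ^ 4 : ℕ) : ℝ) < 1 ∧ 0 < ℓ₀ ∧
        (∀ k, 0 ≤ sch.β k ∧ 1 ≤ bseq k ∧
          (∀ w : Fin 4 → ℤ → ℤ, (∀ i j, w i j + (bseq k : ℤ) ≤ w i (j + 1) ∧ w i (j + 1) ≤ w i j + 2 * (bseq k : ℤ)) →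
            ∀ Y : Finset (Fin 4 → ℤ), Y ⊆ (Fintype.piFinset fun _ : Fin 4 => Finset.Icc (-(2 * (n : ℤ))) (2 * (n : ℤ))) →
            (0 : Fin 4 → ℤ) ∈ Y → ∀ η η' : LGConfig 4 G,
            (∀ e ∈ (Fintype.piFinset fun _ : Fin 4 => Finset.Icc (-(2 * (n : ℤ))) (2 * (n : ℤ))).biUnion
              (fun y : Fin 4 → ℤ => (Fintype.piFinset fun i : Fin 4 => Finset.Ico (w i (y i)) (w i (y i + 1))) ×ˢ
                (Finset.univ : Finset (Fin 4))), η e = η' e) →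
            ∀ f : LGConfig 4 G → ℝ, IsCylinder f ((fun y : Fin 4 → ℤ => (Fintype.piFinset fun i : Fin 4 =>
              Finset.Ico (w i (y i)) (w i (y i + 1))) ×ˢ (Finset.univ : Finset (Fin 4))) 0) → Measurable f →
            (∀ U, 0 ≤ f U ∧ f U ≤ 1) →
            |(∫ U, f U ∂(ymSpecification r.ρ (sch.β k) (Y.biUnion (fun y : Fin 4 → ℤ => (Fintype.piFinset
                fun i : Fin 4 => Finset.Ico (w i (y i)) (w i (y i + 1))) ×ˢ (Finset.univ : Finset (Fin 4)))) η)) -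
              ∫ U, f U ∂(ymSpecification r.ρ (sch.β k) (Y.biUnion (fun y : Fin 4 → ℤ => (Fintype.piFinset
                fun i : Fin 4 => Finset.Ico (w i (y i)) (w i (y i + 1))) ×ˢ (Finset.univ : Finset (Fin 4)))) η')| ≤ ε)) ∧
        (∀ k, sch.a k = ℓ₀ / (bseq k : ℝ)) ∧
        (∀ k, (8 * n + 7) * bseq k ≤ 2 * sch.L k + 1 ∧ Real.log (|sch.c r.curvature k| + 1) ^ 2 ≤ sch.a k * sch.L k) ∧
        sch.HasWeakCouplingLimit ∧
        (∀ n k, (∃ i, k i ≠ r.curvature) → ∀ F, S n k F = 0) ∧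
        (∀ n, n ≠ 0 → ∀ (σ : Fin n → YMSpecies G) (f : Fin n → SchwartzMap E ℝ) (F : SchwartzMap (Fin n → E) ℂ),
          IsTensorOf F (fun i => ofRealTest (f i)) → IsOffDiagonal F →
          Filter.Tendsto (fun k => (latticeSchwinger r.ρ sch (fun s => s.F) k n σ f : ℂ)) Filter.atTop (nhds (S n σ F))) ∧
        S.IsNormalized ∧
        S.IsHermitian ∧
        S.HasLinearGrowth ∧
        S.IsReflectionPositive ∧
        S.IsSymmetric ∧
        (∀ (n : ℕ) (k : Fin n → YMSpecies G) (a : E) (F : SchwartzMap (Fin n → E) ℂ), IsOffDiagonal F →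
          S n k (translateMulti a F) = S n k F) ∧
        (∀ (n : ℕ) (k : Fin n → YMSpecies G) (R : E ≃ₗᵢ[ℝ] E), LinearMap.det (R.toLinearEquiv : E →ₗ[ℝ] E) = 1 →
          (∀ i : Fin 4, ∃ j : Fin 4, R (EuclideanSpace.single i 1) = EuclideanSpace.single j 1 ∨
            R (EuclideanSpace.single i 1) = -EuclideanSpace.single j 1) →
          ∀ F : SchwartzMap (Fin n → E) ℂ, IsOffDiagonal F → S n k (linActMulti R F) = S n k F) ∧
        (∃ (F₁ G₁ : SchwartzMap (Fin 1 → E) ℂ) (H₁ : SchwartzMap (Fin (1 + 1) → E) ℂ), IsTimeOrdered F₁ ∧ IsTimeOrdered G₁ ∧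
          IsAppendTensorOf H₁ (osAdjoint F₁) G₁ ∧
          S (1 + 1) (fun _ => r.curvature) H₁ ≠ S 1 (fun _ => r.curvature) (osAdjoint F₁) * S 1 (fun _ => r.curvature) G₁) ∧
        (∃ (f g h : SchwartzMap E ℂ) (Ffgh : SchwartzMap (Fin 3 → E) ℂ) (Fgh Ffh Ffg : SchwartzMap (Fin 2 → E) ℂ)
          (Ff Fg Fh : SchwartzMap (Fin 1 → E) ℂ), IsTensorOf Ffgh ![f, g, h] ∧ IsOffDiagonal Ffgh ∧ IsTensorOf Fgh ![g, h] ∧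
          IsTensorOf Ffh ![f, h] ∧ IsTensorOf Ffg ![f, g] ∧ IsTensorOf Ff ![f] ∧ IsTensorOf Fg ![g] ∧ IsTensorOf Fh ![h] ∧
          S 3 (fun _ => r.curvature) Ffgh - S 1 (fun _ => r.curvature) Ff * S 2 (fun _ => r.curvature) Fgh -
            S 1 (fun _ => r.curvature) Fg * S 2 (fun _ => r.curvature) Ffh -
            S 1 (fun _ => r.curvature) Fh * S 2 (fun _ => r.curvature) Ffg +
            2 * (S 1 (fun _ => r.curvature) Ff * S 1 (fun _ => r.curvature) Fg * S 1 (fun _ => r.curvature) Fh) ≠ 0))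
    (h₂ : Summit.QuantumFields.YangMills.Theses.CertificationLength.LatticeGapAtCertificationScale)
    (h₃ : let E := EuclideanSpace ℝ (Fin 4)
      ∀ (G : Type) [Group G] [TopologicalSpace G] [IsTopologicalGroup G] [CompactSpace G] [MeasurableSpace G]
        [BorelSpace G] (r : LatticeRep G) (n : ℕ) (ε ℓ₀ : ℝ) (bseq : ℕ → ℕ) (sch : SpeciesScheme (YMSpecies G))
        (S : LabelledSchwingerFamily (YMSpecies G) E),
        1 ≤ n → 0 ≤ ε → ε * (((4 * n + 3) ^ 4 - (4 * n + 1) ^ 4 : ℕ) : ℝ) < 1 → 0 < ℓ₀ →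
        (∀ k, 0 ≤ sch.β k ∧ 1 ≤ bseq k ∧
          (∀ w : Fin 4 → ℤ → ℤ, (∀ i j, w i j + (bseq k : ℤ) ≤ w i (j + 1) ∧ w i (j + 1) ≤ w i j + 2 * (bseq k : ℤ)) →
            ∀ Y : Finset (Fin 4 → ℤ), Y ⊆ (Fintype.piFinset fun _ : Fin 4 => Finset.Icc (-(2 * (n : ℤ))) (2 * (n : ℤ))) →
            (0 : Fin 4 → ℤ) ∈ Y → ∀ η η' : LGConfig 4 G,
            (∀ e ∈ (Fintype.piFinset fun _ : Fin 4 => Finset.Icc (-(2 * (n : ℤ))) (2 * (n : ℤ))).biUnion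
              (fun y : Fin 4 → ℤ => (Fintype.piFinset fun i : Fin 4 => Finset.Ico (w i (y i)) (w i (y i + 1))) ×ˢ
                (Finset.univ : Finset (Fin 4))), η e = η' e) →
            ∀ f : LGConfig 4 G → ℝ, IsCylinder f ((fun y : Fin 4 → ℤ => (Fintype.piFinset fun i : Fin 4 =>
              Finset.Ico (w i (y i)) (w i (y i + 1))) ×ˢ (Finset.univ : Finset (Fin 4))) 0) → Measurable f →
            (∀ U, 0 ≤ f U ∧ f U ≤ 1) →
            |(∫ U, f U ∂(ymSpecification r.ρ (sch.β k) (Y.biUnion (fun y : Fin 4 → ℤ => (Fintype.piFinset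
                fun i : Fin 4 => Finset.Ico (w i (y i)) (w i (y i + 1))) ×ˢ (Finset.univ : Finset (Fin 4)))) η)) -
              ∫ U, f U ∂(ymSpecification r.ρ (sch.β k) (Y.biUnion (fun y : Fin 4 → ℤ => (Fintype.piFinset
                fun i : Fin 4 => Finset.Ico (w i (y i)) (w i (y i + 1))) ×ˢ (Finset.univ : Finset (Fin 4)))) η')| ≤ ε)) →
        (∀ k, sch.a k = ℓ₀ / (bseq k : ℝ)) →
        (∀ k, (8 * n + 7) * bseq k ≤ 2 * sch.L k + 1 ∧ Real.log (|sch.c r.curvature k| + 1) ^ 2 ≤ sch.a k * sch.L k) →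
        (∀ n k, (∃ i, k i ≠ r.curvature) → ∀ F, S n k F = 0) →
        (∀ n, n ≠ 0 → ∀ (σ : Fin n → YMSpecies G) (f : Fin n → SchwartzMap E ℝ) (F : SchwartzMap (Fin n → E) ℂ),
          IsTensorOf F (fun i => ofRealTest (f i)) → IsOffDiagonal F →
          Filter.Tendsto (fun k => (latticeSchwinger r.ρ sch (fun s => s.F) k n σ f : ℂ)) Filter.atTop (nhds (S n σ F))) →
        S.IsNormalized →
        S.IsHermitian →
        S.HasLinearGrowth →
        S.IsReflectionPositive →
        S.IsSymmetric →
        (∀ (n : ℕ) (k : Fin n → YMSpecies G) (a : E) (F : SchwartzMap (Fin n → E) ℂ), IsOffDiagonal F →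
          S n k (translateMulti a F) = S n k F) →
        (∀ (n : ℕ) (k : Fin n → YMSpecies G) (R : E ≃ₗᵢ[ℝ] E), LinearMap.det (R.toLinearEquiv : E →ₗ[ℝ] E) = 1 →
          (∀ i : Fin 4, ∃ j : Fin 4, R (EuclideanSpace.single i 1) = EuclideanSpace.single j 1 ∨
            R (EuclideanSpace.single i 1) = -EuclideanSpace.single j 1) →
          ∀ F : SchwartzMap (Fin n → E) ℂ, IsOffDiagonal F → S n k (linActMulti R F) = S n k F) →
        S.HasClusterProperty ∧ ∃ Δ : ℝ, 0 < Δ ∧ S.HasMassGap Δ) :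
    Summit.QuantumFields.YangMills.Theses.CertificationLength.CertifiedHypercubicLimit := by
  intro hA G _ _ _ _ hG
  letI : MeasurableSpace G := borel G
  haveI : BorelSpace G := ⟨rfl⟩
  show ∀ r : LatticeRep G, _
  intro r
  obtain ⟨n, ε, ℓ₀, bseq, sch, S, hn, hε, hM, hℓ, hcert, ha, hL, hweak, hzero, hconv, hnorm, hherm, hgrowth,
    hrp, hsymm, htr, hhyp, hnt, hng⟩ := h₁ hA G hG r
  obtain ⟨Δ₁, hΔ₁, hlat⟩ := h₂ G r n ε hn hε hM ℓ₀ hℓ bseq sch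
    (fun k => ⟨(hcert k).2.1, (hcert k).2.2⟩) ha (fun k => (hL k).1)
  obtain ⟨hclus, Δ₂, hΔ₂, hgap⟩ := h₃ G r n ε ℓ₀ bseq sch S hn hε hM hℓ hcert ha hL hzero
    hconv hnorm hherm hgrowth hrp hsymm htr hhyp
  exact ⟨n, ε, ℓ₀, bseq, sch, S, hn, hε, hM, hℓ, hcert, ha, hL, hweak, hzero,
    ⟨hnorm, hherm, hgrowth, hrp, hsymm, hclus, htr, hhyp⟩, hconv, hnt, hng, min Δ₁ Δ₂, lt_min hΔ₁ hΔ₂,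
    hasMassGap_anti hgap (min_le_right _ _), hasLatticeMassGap_anti r sch hlat (min_le_left _ _)⟩

end Summit.QuantumFields.YangMills.Cruxes.CertifiedHypercubicLimit.Birth
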